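import Summits.CriticalPhenomena.PercolationContinuityZ3.Theorems.PercNearOneGluingNoHeavyLowerTailSahiCombJuntaAllOrders
import Summits.CriticalPhenomena.PercolationContinuityZ3.Theorems.PercNearOneGluingNoHeavyLowerTailSahiCombDominationAllOrders

/-!
# THE JUNTA-INTERSECTION THEOREM AT EVERY ORDER — Sahi's `C_n` (comb level) for one arbitrary increasing event together with
# any number of increasing events whose PAIRWISE INTERSECTIONS read few common coordinates, in every dimension

Support file (cell `prim-sahi`, seat `prim-sahi-typer` gen 36; `--supports stmt-CriticalPhenomena-4575`; proposed `--computational` because the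
five-letter instances inherit the declared `native_decide` axioms of `SahiCombFive.combPos_sahiE_of_card_le_five_all`; Parts 1–3 are pure,
standard axioms).  No definitions, no named facts, no `sorry`.

P3's junta-intersection theorem (`SahiCombJunta.combPos_sahiE_three_of_inter_determinedBy`, order `3`): (M⁺-3) on the cube `↥W` ⟹ (M⁺-3) for
`(U, A, B)` with `U` arbitrary and `A ∩ B` determined by `W`.  Its three steps all exist at every order in the tree or in the companion file
`…SahiCombJuntaAllOrders` (this generation): the DOMINATION IDENTITY at every order (`SahiCombDomination.sahiE_cons_domination`, P3/P5), the
PEELING of a free slot and the SUB-CUBE TRANSPORT at every order.  What has to be added is bookkeeping, and one observation: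

  (★) if `A` and `B` are increasing and `A ∩ B` is `W`-determined, then the `W`-determined enlargement `A^{Wᶜ} = {ω | ω ∪ Wᶜ ∈ A}` satisfies
      `A^{Wᶜ} ∩ B = A ∩ B` (`secUnion_compl_inter_eq_of_determinedBy`)

— so enlarging one slot to a junta KEEPS all the `W`-determined pairwise intersections of the family, and the top term of the domination
identity vanishes against ANY partner slot.  Hence, by induction on the order (for the sub-families in the identity) and on the number of
non-junta slots (enlarging them one at a time, each time with per-sub-family hypotheses —
`combPos_sahiE_cons_of_enlarge_of_subfamilies`, the refined form of P3's `combPos_sahiE_cons_of_enlarge` whose lower-order hypotheses are the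
sub-families of the tail only, not the whole lower rows of the hierarchy):

**THEOREM (`combPos_sahiE_of_pairwise_inter_determinedBy`).**  Let `W ⊆ ι` and suppose (M⁺-k) holds on the cube `↥W` for every `k` and every
`k`-family of increasing events.  Let `X_0,…,X_{n−1} ⊆ 2^ι` be increasing events and `free` a set of at most one slot such that
`X_a ∩ X_b` is `W`-determined for all distinct non-free slots `a, b`.  Then `p ↦ E_n(μ_p; 1_{X_0},…,1_{X_{n−1}})` is comb-positive of
multidegree `n` on `[0,1]^ι`.
With the five-letter all-orders certificate: **`combPos_sahiE_of_pairwise_inter_determinedBy_card_le_five`** (`|W| ≤ 5`, free slot `k`),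
the law-level form `sahiE_ind_nonneg_…` — Sahi's `C_n` [Sahi2008, Conj. 5; LiebSahi2022, Conj. 1.1] for EVERY `n`, every product measure, every
dimension, on the class "one arbitrary increasing event + increasing events whose pairwise intersections read `≤ 5` common coordinates" — and
order `4` written out (`combPos_sahiE_four_of_inter_determinedBy_card_le_five`: `E₄(U,A,B,C)` for `A ∩ B`, `A ∩ C`, `B ∩ C` five-juntas on a
common `W`, `U` arbitrary).  At order `3` the theorem is P3's (there with `|W| ≤ 6` by gen 35); at orders `n ≥ 4` it is new.
HONEST LABEL: Parts 1–3 pure; Part 4 computational (closure as stated); Sahi's `C_n` in general remains OPEN. [this work]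
-/

noncomputable section

open scoped Classical

namespace Summit.CriticalPhenomena.PercolationContinuityZ3.Theorems

namespace SahiCombJunta

open Finset Function
open scoped Nat
open Literature.Combinatorics.Sahi2008
open Literature.Probability.Percolation (DeterminedBy determinedBy_iff)
open Literature.Probability.Percolation.DecisionTree (ind ind_of_mem ind_of_not_mem ind_nonneg)
open SahiComb SahiCombDomination

variable {ι : Type} [Fintype ι]

/-! ### Part 1.  Refined domination: per-sub-family hypotheses -/

/-- **Domination with per-sub-family hypotheses** (refines P3's `SahiCombDomination.combPos_sahiE_cons_of_enlarge`, same proof): for events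
`A ⊆ A'` at the head, a tail `V_0,…,V_m` with `A' ∩ V_{i₀} = A ∩ V_{i₀}` for some `i₀`, comb positivity of `E_{m+1}(1_V)` and of `E` of every
sub-family of `V`, and comb positivity (multidegree `m+2`) of `E_{m+2}(1_{A'}, 1_V)`: then `E_{m+2}(1_A, 1_V)` is comb-positive. [this work] -/
theorem combPos_sahiE_cons_of_enlarge_of_subfamilies {m : ℕ} {A A' : Set (Set ι)} (V : Fin (m + 1) → Set (Set ι))
    (hAA' : A ⊆ A') (i₀ : Fin (m + 1)) (hK : A' ∩ V i₀ = A ∩ V i₀)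
    (hg : CombPos (fun _ : ι => m + 1) (fun p => sahiE (bernoulliWeight p) (m + 1) (fun j => ind (V j))))
    (hsub : ∀ T : Finset (Fin (m + 1)), CombPos (fun _ : ι => Tᶜ.card)
      (fun p => sahiE (bernoulliWeight p) Tᶜ.card (fun j => ind (V (Tᶜ.orderEmbOfFin rfl j)))))
    (h : CombPos (fun _ : ι => m + 2)
      (fun p => sahiE (bernoulliWeight p) (m + 2) (Fin.cons (ind A') (fun j => ind (V j)) : Fin (m + 2) → Set ι → ℝ))) :
    CombPos (fun _ : ι => m + 2)
      (fun p => sahiE (bernoulliWeight p) (m + 2) (Fin.cons (ind A) (fun j => ind (V j)) : Fin (m + 2) → Set ι → ℝ)) := by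
  have hδ : CombPos (fun _ : ι => 1) (fun p => ex (bernoulliWeight p) (ind A') - ex (bernoulliWeight p) (ind A)) :=
    combPos_ex_sub_of_subset hAA'
  have hdefect : ∀ T : Finset (Fin (m + 1)), CombPos (fun _ : ι => 1)
      (fun p => ex (bernoulliWeight p) ((ind A' - ind A) * ∏ i ∈ T, ind (V i))) := fun T =>
    combPos_ex (ind_sub_mul_prod_nonneg hAA' V T)
  have hdeg : (fun _ : ι => (1 : ℕ)) + (fun _ : ι => m + 1) = fun _ : ι => m + 2 := by
    funext e; simp only [Pi.add_apply]; omega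
  have hterm : ∀ T ∈ (univ : Finset (Finset (Fin (m + 1)))).filter (fun T => T.Nonempty ∧ T ≠ univ),
      CombPos (fun _ : ι => m + 2) (fun p => ((T.card)! : ℝ) *
        (ex (bernoulliWeight p) ((ind A' - ind A) * ∏ i ∈ T, ind (V i)) *
          sahiE (bernoulliWeight p) Tᶜ.card (fun j => ind (V (Tᶜ.orderEmbOfFin rfl j))))) := by
    intro T _
    refine ((hdefect T).mul_of_le (hsub T) fun e => ?_).smul (Nat.cast_nonneg _)
    simp only [Pi.add_apply]
    have := Finset.card_le_univ Tᶜ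
    simp only [Fintype.card_fin] at this
    omega
  have htop : (ind A' - ind A) * ∏ i, ind (V i) = 0 := ind_sub_mul_prod_univ_eq_zero V i₀ hK
  have htot := ((h.add (hδ.mul_of_eq hg hdeg)).add (CombPos.sum _ hterm)).add (CombPos.zero (fun _ : ι => m + 2))
  refine htot.congr fun p => ?_
  rw [sahiE_cons_domination (bernoulliWeight p) m A A' V, htop]
  have h0 : ex (bernoulliWeight p) (0 : Set ι → ℝ) = 0 := by simp [ex_def]
  rw [h0]
  ring

/-! ### Part 2.  Enlargement keeps determined intersections; a slot to the head -/

omit [Fintype ι] in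
/-- **(★)** For increasing `A, B` with `A ∩ B` determined by `W`: `A^{Wᶜ} ∩ B = A ∩ B`. [this work] -/
theorem secUnion_compl_inter_eq_of_determinedBy {W : Set ι} {A B : Set (Set ι)} (hA : IsUpperSet A) (hB : IsUpperSet B)
    (hAB : DeterminedBy (A ∩ B) W) : secUnion Wᶜ A ∩ B = A ∩ B := by
  ext ω
  constructor
  · rintro ⟨hAω, hBω⟩
    rw [mem_secUnion] at hAω
    have hB' : ω ∪ Wᶜ ∈ B := hB Set.subset_union_left hBω
    have key := (determinedBy_iff _ _).1 hAB (ω ∪ Wᶜ) ω (by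
      ext x; simp only [Set.mem_inter_iff, Set.mem_union, Set.mem_compl_iff]; tauto)
    exact key.1 ⟨hAω, hB'⟩
  · rintro ⟨hAω, hBω⟩
    exact ⟨subset_secUnion Wᶜ hA hAω, hBω⟩

omit [Fintype ι] in
/-- `secUnion Wᶜ X` is `W`-determined. [folklore] -/
theorem determinedBy_secUnion_compl (W : Set ι) (X : Set (Set ι)) : DeterminedBy (secUnion Wᶜ X) W := by
  simpa using SahiCombPrincipalMeet.determinedBy_secUnion Wᶜ X

/-- **A slot to the head**: `E_{m+2}(F) = E_{m+2}(F_i, (F_{swap(0,i)(j+1)})_j)` (slot symmetry `sahiE_comp_perm`). [this work] -/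
theorem sahiE_eq_cons_swap {α : Type*} [Fintype α] (μ : α → ℝ) {m : ℕ} (F : Fin (m + 2) → α → ℝ) (i : Fin (m + 2)) :
    sahiE μ (m + 2) F = sahiE μ (m + 2) (Fin.cons (F i) (fun j => F (Equiv.swap 0 i (Fin.succ j))) : Fin (m + 2) → α → ℝ) := by
  rw [← sahiE_comp_perm μ (m + 2) (Equiv.swap 0 i) F]
  congr 1
  funext l
  refine Fin.cases ?_ (fun j => ?_) l
  · simp only [Equiv.swap_apply_left, Fin.cons_zero]
  · simp only [Fin.cons_succ]

/-! ### Part 3.  The engine: induction on the order and on the number of non-junta slots -/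

/-- **THE JUNTA-INTERSECTION THEOREM AT EVERY ORDER** (see the module docstring).  `free` marks at most one slot; all other pairwise
intersections are `W`-determined; (M⁺-k) on the cube `↥W` for all `k` is the hypothesis `hcube`. [this work] -/
theorem combPos_sahiE_of_pairwise_inter_determinedBy (W : Set ι)
    (hcube : ∀ (k : ℕ) (Y : Fin k → Set (Set ↥W)), (∀ i, IsUpperSet (Y i)) →
      CombPos (fun _ : ↥W => k) (fun q => sahiE (bernoulliWeight q) k (fun i => ind (Y i)))) :
    ∀ (n : ℕ) (X : Fin n → Set (Set ι)) (free : Fin n → Prop), (∀ i, IsUpperSet (X i)) →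
      (∀ a b, free a → free b → a = b) →
      (∀ a b, a ≠ b → ¬ free a → ¬ free b → DeterminedBy (X a ∩ X b) W) →
      CombPos (fun _ : ι => n) (fun p => sahiE (bernoulliWeight p) n (fun i => ind (X i))) := by
  intro n
  induction n using Nat.strong_induction_on with
  | _ n IH =>
  intro X free hX hfree hpair
  rcases Nat.lt_or_ge n 3 with hn | hn
  · exact masterFamilyCombPos_of_le_two (by omega) ι X hX
  obtain ⟨m, rfl⟩ : ∃ m, n = m + 2 := ⟨n - 2, by omega⟩
  -- inner induction on the number of non-free, non-junta slots
  suffices inner : ∀ (c : ℕ) (X : Fin (m + 2) → Set (Set ι)), (∀ i, IsUpperSet (X i)) →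
      (∀ a b, a ≠ b → ¬ free a → ¬ free b → DeterminedBy (X a ∩ X b) W) →
      (univ.filter fun a => ¬ free a ∧ ¬ DeterminedBy (X a) W).card ≤ c →
      CombPos (fun _ : ι => m + 2) (fun p => sahiE (bernoulliWeight p) (m + 2) (fun i => ind (X i))) from
    inner _ X hX hpair le_rfl
  intro c
  induction c with
  | zero =>
    intro X hX hpair hc
    have hdet : ∀ a, ¬ free a → DeterminedBy (X a) W := fun a ha => by
      by_contra hnd
      have hmem : a ∈ univ.filter (fun a => ¬ free a ∧ ¬ DeterminedBy (X a) W) := by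
        simp only [mem_filter, mem_univ, true_and]; exact ⟨ha, hnd⟩
      have := card_pos.2 ⟨a, hmem⟩
      omega
    by_cases hex : ∃ u, free u
    · obtain ⟨u, hu⟩ := hex
      exact combPos_sahiE_of_allButOne_determinedBy W (hcube (m + 2)) u hX fun i hi =>
        hdet i fun hfi => hi (hfree i u hfi hu)
    · push Not at hex
      exact combPos_sahiE_of_determinedBy_all_order W (hcube (m + 2)) hX fun i => hdet i (hex i)
  | succ c ihc =>
    intro X hX hpair hc
    by_cases hall : ∀ a, ¬ free a → DeterminedBy (X a) W
    · refine ihc X hX hpair ?_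
      have h0 : univ.filter (fun a => ¬ free a ∧ ¬ DeterminedBy (X a) W) = ∅ :=
        filter_eq_empty_iff.2 fun a _ h => h.2 (hall a h.1)
      rw [h0, card_empty]
      exact Nat.zero_le _
    push Not at hall
    obtain ⟨i, hfi, hnd⟩ := hall
    -- move slot `i` to the head
    set s : Equiv.Perm (Fin (m + 2)) := Equiv.swap 0 i with hs
    have hs0 : s 0 = i := by rw [hs, Equiv.swap_apply_left]
    have hsucc_ne : ∀ j : Fin (m + 1), s (Fin.succ j) ≠ i := fun j h => by
      have : Fin.succ j = (0 : Fin (m + 2)) := s.injective (h.trans hs0.symm)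
      exact Fin.succ_ne_zero _ this
    have hsucc_inj : ∀ j j' : Fin (m + 1), s (Fin.succ j) = s (Fin.succ j') → j = j' := fun j j' h =>
      Fin.succ_injective _ (s.injective h)
    -- a non-free partner among the other slots (there are `m + 1 ≥ 2` of them and at most one is free)
    obtain ⟨j₀, hj₀⟩ : ∃ j₀ : Fin (m + 1), ¬ free (s (Fin.succ j₀)) := by
      by_contra hno
      push Not at hno
      have hm : 1 < m + 1 := by omega
      have h01 := hfree _ _ (hno ⟨0, by omega⟩) (hno ⟨1, hm⟩)
      have := hsucc_inj _ _ h01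
      simp [Fin.ext_iff] at this
    set V : Fin (m + 1) → Set (Set ι) := fun j => X (s (Fin.succ j)) with hV
    have hVup : ∀ j, IsUpperSet (V j) := fun j => hX _
    -- sub-families of the tail, through the outer induction hypothesis
    have hIH : ∀ (k : ℕ) (emb : Fin k → Fin (m + 1)), Function.Injective emb → k < m + 2 →
        CombPos (fun _ : ι => k) (fun p => sahiE (bernoulliWeight p) k (fun l => ind (V (emb l)))) := by
      intro k emb hemb hk
      refine IH k hk (fun l => V (emb l)) (fun l => free (s (Fin.succ (emb l)))) (fun l => hVup _)
        (fun a b ha hb => hemb (hsucc_inj _ _ (hfree _ _ ha hb))) fun a b hab ha hb => ?_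
      exact hpair _ _ (fun h => hab (hemb (hsucc_inj _ _ h))) ha hb
    have hg : CombPos (fun _ : ι => m + 1) (fun p => sahiE (bernoulliWeight p) (m + 1) (fun j => ind (V j))) :=
      hIH (m + 1) id injective_id (by omega)
    have hsub : ∀ T : Finset (Fin (m + 1)), CombPos (fun _ : ι => Tᶜ.card)
        (fun p => sahiE (bernoulliWeight p) Tᶜ.card (fun j => ind (V (Tᶜ.orderEmbOfFin rfl j)))) := fun T =>
      hIH Tᶜ.card (fun j => Tᶜ.orderEmbOfFin rfl j) (Tᶜ.orderEmbOfFin rfl).injective (by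
        have := Finset.card_le_univ Tᶜ
        simp only [Fintype.card_fin] at this
        omega)
    -- the enlarged family
    set A' : Set (Set ι) := secUnion Wᶜ (X i) with hA'
    set X' : Fin (m + 2) → Set (Set ι) := update X i A' with hX'
    have hX'i : X' i = A' := by rw [hX', update_self]
    have hX'ne : ∀ l, l ≠ i → X' l = X l := fun l hl => by rw [hX', update_of_ne hl]
    have hX'up : ∀ l, IsUpperSet (X' l) := fun l => by
      by_cases hl : l = i
      · subst hl; rw [hX'i, hA']; exact isUpperSet_secUnion _ (hX l)
      · rw [hX'ne l hl]; exact hX l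
    have hA'det : DeterminedBy A' W := determinedBy_secUnion_compl W (X i)
    have hinter : ∀ b, b ≠ i → ¬ free b → A' ∩ X b = X i ∩ X b := fun b hb hfb =>
      secUnion_compl_inter_eq_of_determinedBy (hX i) (hX b) (hpair i b (Ne.symm hb) hfi hfb)
    have hpair' : ∀ a b, a ≠ b → ¬ free a → ¬ free b → DeterminedBy (X' a ∩ X' b) W := by
      intro a b hab ha hb
      by_cases hai : a = i
      · subst hai
        rw [hX'i, hX'ne b (Ne.symm hab), hinter b (Ne.symm hab) hb]
        exact hpair a b hab ha hb
      · by_cases hbi : b = i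
        · subst hbi
          rw [hX'i, hX'ne a hai, Set.inter_comm, hinter a hai ha, Set.inter_comm]
          exact hpair a b hab ha hb
        · rw [hX'ne a hai, hX'ne b hbi]
          exact hpair a b hab ha hb
    have hc' : (univ.filter fun a => ¬ free a ∧ ¬ DeterminedBy (X' a) W).card ≤ c := by
      have hsubset : (univ.filter fun a => ¬ free a ∧ ¬ DeterminedBy (X' a) W) ⊆
          (univ.filter fun a => ¬ free a ∧ ¬ DeterminedBy (X a) W).erase i := by
        intro a ha
        simp only [mem_filter, mem_univ, true_and, mem_erase] at ha ⊢
        have hai : a ≠ i := by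
          rintro rfl
          exact ha.2 (by rw [hX'i]; exact hA'det)
        rw [hX'ne a hai] at ha
        exact ⟨hai, ha⟩
      have hmem : i ∈ univ.filter (fun a => ¬ free a ∧ ¬ DeterminedBy (X a) W) := by
        simp only [mem_filter, mem_univ, true_and]; exact ⟨hfi, hnd⟩
      have h1 := card_le_card hsubset
      rw [card_erase_of_mem hmem] at h1
      omega
    -- the main term: the enlarged family, by the inner induction hypothesis, in head form
    have hmain : CombPos (fun _ : ι => m + 2)
        (fun p => sahiE (bernoulliWeight p) (m + 2) (Fin.cons (ind A') (fun j => ind (V j)) : Fin (m + 2) → Set ι → ℝ)) := by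
      refine (ihc X' hX'up hpair' hc').congr fun p => ?_
      rw [sahiE_eq_cons_swap (bernoulliWeight p) (fun l => ind (X' l)) i]
      congr 1
      funext l
      refine Fin.cases ?_ (fun j => ?_) l
      · simp only [Fin.cons_zero, hX'i]
      · simp only [Fin.cons_succ]
        rw [hX'ne _ (hsucc_ne j)]
    -- domination
    have hdom := combPos_sahiE_cons_of_enlarge_of_subfamilies V (subset_secUnion Wᶜ (hX i)) j₀
      (hinter _ (hsucc_ne j₀) hj₀) hg hsub hmain
    refine hdom.congr fun p => ?_
    rw [sahiE_eq_cons_swap (bernoulliWeight p) (fun l => ind (X l)) i]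

/-! ### Part 4.  Five letters: every order, every dimension -/

/-- **THE JUNTA-INTERSECTION THEOREM AT EVERY ORDER, FIVE COORDINATES.**  For every `n`, every finite `ι`, every `W ⊆ ι` with `|W| ≤ 5`, a slot
`k`, and increasing events `X_0,…,X_{n−1}` such that `X_a ∩ X_b` is determined by `W` for all distinct `a, b ≠ k` (the slot `k` is arbitrary):
`p ↦ E_n(μ_p; 1_{X_0},…,1_{X_{n−1}})` is a nonnegative combination of the degree-`n` tensor-Bernstein basis on `[0,1]^ι`. [this work]
[computational] -/
theorem combPos_sahiE_of_pairwise_inter_determinedBy_card_le_five (W : Finset ι) (hW : W.card ≤ 5) {n : ℕ} (k : Fin n)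
    {X : Fin n → Set (Set ι)} (hX : ∀ i, IsUpperSet (X i))
    (hpair : ∀ a b, a ≠ b → a ≠ k → b ≠ k → DeterminedBy (X a ∩ X b) (↑W : Set ι)) :
    CombPos (fun _ : ι => n) (fun p => sahiE (bernoulliWeight p) n (fun i => ind (X i))) :=
  combPos_sahiE_of_pairwise_inter_determinedBy (↑W : Set ι) (cubeCombPos_all_of_card_le_five _ (by
    rw [← Set.toFinset_card, Finset.toFinset_coe]
    exact hW)) n X (fun a => a = k) hX (fun a b ha hb => ha.trans hb.symm) hpair

/-- Law level: **Sahi's `C_n` for every product measure, every order, every dimension**, for one arbitrary increasing event (slot `k`) together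
with increasing events whose pairwise intersections read at most five common coordinates. [this work] [computational] -/
theorem sahiE_ind_nonneg_of_pairwise_inter_determinedBy_card_le_five (p : ι → unitInterval) (W : Finset ι) (hW : W.card ≤ 5) {n : ℕ}
    (k : Fin n) {X : Fin n → Set (Set ι)} (hX : ∀ i, IsUpperSet (X i))
    (hpair : ∀ a b, a ≠ b → a ≠ k → b ≠ k → DeterminedBy (X a ∩ X b) (↑W : Set ι)) :
    0 ≤ sahiE (bernoulliWeight p) n (fun i => ind (X i)) :=
  (combPos_sahiE_of_pairwise_inter_determinedBy_card_le_five W hW k hX hpair).nonneg p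

/-- Density-free zero set on the class. [this work] [computational] -/
theorem sahiE_ind_eq_zero_of_interior_zero_of_pairwise_inter_determinedBy_card_le_five (W : Finset ι) (hW : W.card ≤ 5) {n : ℕ}
    (k : Fin n) {X : Fin n → Set (Set ι)} (hX : ∀ i, IsUpperSet (X i))
    (hpair : ∀ a b, a ≠ b → a ≠ k → b ≠ k → DeterminedBy (X a ∩ X b) (↑W : Set ι))
    {q : ι → unitInterval} (hq : ∀ e, (q e : ℝ) ∈ Set.Ioo (0 : ℝ) 1) (h0 : sahiE (bernoulliWeight q) n (fun i => ind (X i)) = 0)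
    (p : ι → unitInterval) : sahiE (bernoulliWeight p) n (fun i => ind (X i)) = 0 :=
  (combPos_sahiE_of_pairwise_inter_determinedBy_card_le_five W hW k hX hpair).eq_zero_of_interior hq h0 p

/-- **Order four, written out**: for increasing `U, A, B, C ⊆ 2^ι` with `A ∩ B`, `A ∩ C`, `B ∩ C` determined by a common set of at most five
coordinates and `U` ARBITRARY, `p ↦ E₄(μ_p; 1_U, 1_A, 1_B, 1_C)` is comb-positive (hence `≥ 0` for every product measure). [this work]
[computational] -/
theorem combPos_sahiE_four_of_inter_determinedBy_card_le_five (W : Finset ι) (hW : W.card ≤ 5) {U A B C : Set (Set ι)}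
    (hU : IsUpperSet U) (hA : IsUpperSet A) (hB : IsUpperSet B) (hC : IsUpperSet C)
    (hAB : DeterminedBy (A ∩ B) (↑W : Set ι)) (hAC : DeterminedBy (A ∩ C) (↑W : Set ι)) (hBC : DeterminedBy (B ∩ C) (↑W : Set ι)) :
    CombPos (fun _ : ι => 4) (fun p => sahiE (bernoulliWeight p) 4 (fun i => ind (![U, A, B, C] i))) := by
  refine combPos_sahiE_of_pairwise_inter_determinedBy_card_le_five W hW (0 : Fin 4) (X := ![U, A, B, C]) ?_ ?_
  · intro i
    fin_cases i
    · exact hU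
    · exact hA
    · exact hB
    · exact hC
  · intro a b hab ha hb
    fin_cases a <;> fin_cases b <;> first
      | exact absurd rfl hab
      | exact absurd rfl ha
      | exact absurd rfl hb
      | simpa [Set.inter_comm] using hAB
      | simpa [Set.inter_comm] using hAC
      | simpa [Set.inter_comm] using hBC

/-- Order four, law level: `E₄(μ_p; U, A, B, C) ≥ 0`. [this work] [computational] -/
theorem sahiE_four_ind_nonneg_of_inter_determinedBy_card_le_five (p : ι → unitInterval) (W : Finset ι) (hW : W.card ≤ 5)
    {U A B C : Set (Set ι)} (hU : IsUpperSet U) (hA : IsUpperSet A) (hB : IsUpperSet B) (hC : IsUpperSet C)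
    (hAB : DeterminedBy (A ∩ B) (↑W : Set ι)) (hAC : DeterminedBy (A ∩ C) (↑W : Set ι)) (hBC : DeterminedBy (B ∩ C) (↑W : Set ι)) :
    0 ≤ sahiE (bernoulliWeight p) 4 (fun i => ind (![U, A, B, C] i)) :=
  (combPos_sahiE_four_of_inter_determinedBy_card_le_five W hW hU hA hB hC hAB hAC hBC).nonneg p

end SahiCombJunta

end Summit.CriticalPhenomena.PercolationContinuityZ3.Theorems
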